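import Summits.QuantumFields.YangMills.Theorems.ColdStartUniversalityLatticeLangevinHeatKernelDomination
import HarnessLib

/-!
# Route `ColdStartUniversality` (fixed-cut-off package, `β' = 0`): the law of Brownian motion on `SU(2)^E` IS the product
# heat kernel times Haar at EVERY time `t > 0`, and the SU(2) heat kernel is non-negative for all `t > 0`

Helper file (seat `ym-line-csu-p1`, g11, free hands).  The tree's `map_eq_heatKernel_beta_zero` (g7) identifies
`law(U_t) = (∏_e h_t(y_e z_e⁻¹)) · Haar^{⊗E}` only for `t ≥ 2`, because it writes the density with `ENNReal.ofReal` and needs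
`h_t ≥ 0`, available there from `h_t ≥ 1/2`.  g8's shift trick (`map_le_smul_haar_beta_zero`: `law(U_t) + C·Haar = (k + C)·Haar`
for `C ≥ sup |k|`, from the ridge-moment determinacy) removes the restriction:

* `map_add_smul_haar_eq_beta_zero` — the shifted identity `law(U_t) + C·Haar^{⊗E} = (k_t + C)·Haar^{⊗E}` for all `t > 0`
  (g8's internal step, exported);
* ★ `prod_heatKernelSU2_nonneg` — hence `k_t = ∏_e h_t(y_e z_e⁻¹) ≥ 0` everywhere for all `t > 0` (`∫_A k_t ≥ 0` for every
  measurable `A`, continuity, Haar charges open sets);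
* ★ `map_eq_heatKernel_beta_zero_of_pos` — `law(U_t) = k_t · Haar^{⊗E}` for ALL `t > 0`;
* `heatKernelSU2_nonneg`, `heatKernelSU2_one_pos` — the character series `h_t(U) = Σ (n+1) e^{-n(n+2)t/2} χ_n(U)` is `≥ 0` on
  `SU(2)` and `> 0` at `1`, for all `t > 0`.

What this is for: the Doeblin minorisation of the SZZ kernels at SMALL lattice times (`doeblin_szz_haar` covers `t ≥ 2`), needed
by the TP rung `FixedCutoffOverlap` for short windows, reduces with these to a LOCAL lower bound of `h_t` near `1` plus a
spreading argument (not done here).  THEOREMS ONLY, [folklore]; RECORD-rung R3 plumbing; no crux or summit is proved; the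
Yang–Mills mass gap is NOT proved.
-/

set_option autoImplicit false

noncomputable section

namespace Summit.QuantumFields.YangMills.Theorems.ColdStartUniversality

open MeasureTheory Finset ProbabilityTheory Filter
open scoped BigOperators NNReal ENNReal Topology
open Literature.MathematicalPhysics.QuantumFieldTheory
open Literature.MathematicalPhysics.QuantumFieldTheory.Tomboulis2007 (su2Char)
open Literature.MathematicalPhysics.QuantumLattice (fundamentalRep fundamentalLatticeRep continuous_fundamentalRep)
open Literature.Analysis.SpecialFunctions (gegenbauerSum)
open Literature.Probability.Process

variable {L : ℕ} [NeZero L]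

/-- **The shifted identity** (g8's step, exported): for `t > 0`, every `β' = 0` solution `U` from `z` and every `C ≥ sup_y |k_t(z, y)|`,
`law(U_t) + C · Haar^{⊗E} = (k_t(z, ·) + C) · Haar^{⊗E}`. [folklore] -/
theorem map_add_smul_haar_eq_beta_zero {t : ℝ≥0} (ht : 0 < (t : ℝ)) (z : GaugeConfig 3 L (Matrix.specialUnitaryGroup (Fin 2) ℂ))
    {Ω : Type} [MeasurableSpace Ω] {P : Measure Ω} [IsProbabilityMeasure P]
    {W : ℝ≥0 → Ω → (Edge 3 L × NoiseIdx 2 → ℝ)} (hW : IsFlatBrownian W P)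
    {U : ℝ≥0 → Ω → GaugeConfig 3 L (Matrix.specialUnitaryGroup (Fin 2) ℂ)} (hU0 : ∀ ω, U 0 ω = z)
    (hU : (latticeLangevinDynamics (fundamentalLatticeRep 2) 0).IsSolution (fundamentalRep (Fin 2)) hW.natFiltration P W U)
    {C : ℝ} (hC : ∀ y : GaugeConfig 3 L (Matrix.specialUnitaryGroup (Fin 2) ℂ),
      |∏ e, ∑' n : ℕ, ((n : ℝ) + 1) * Real.exp (-((n : ℝ) * ((n : ℝ) + 2) / 2) * t) * su2Char n (y e * (z e)⁻¹)| ≤ C) :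
    P.map (U t) + (ENNReal.ofReal C) • (Measure.pi fun _ : Edge 3 L => haarProbability (Matrix.specialUnitaryGroup (Fin 2) ℂ)) =
      (Measure.pi fun _ : Edge 3 L => haarProbability (Matrix.specialUnitaryGroup (Fin 2) ℂ)).withDensity fun y =>
        ENNReal.ofReal ((∏ e, ∑' n : ℕ, ((n : ℝ) + 1) * Real.exp (-((n : ℝ) * ((n : ℝ) + 2) / 2) * t) *
          su2Char n (y e * (z e)⁻¹)) + C) := by
  classical
  haveI := secondCountableTopology_su2
  haveI := borelSpace_config L
  haveI : IsProbabilityMeasure (haarProbability (Matrix.specialUnitaryGroup (Fin 2) ℂ)) := inferInstance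
  have hC0 : 0 ≤ C := le_trans (abs_nonneg _) (hC z)
  -- the regular flow realises the same law
  haveI := isProbabilityMeasure_piWiener (Edge 3 L × NoiseIdx 2)
  have hWc := isFlatBrownian_piWiener 3 L (NoiseIdx 2)
  obtain ⟨Uc, G, hUc, hUm, -, -, -⟩ := exists_regularFlow L 0 hWc
  have hlaw : P.map (U t) = (Measure.pi fun _ : Edge 3 L × NoiseIdx 2 => preWienerMeasure).map (Uc z t) :=
    lawUnique_of_start 0 z hW hWc hU0 hU (fun ω => (hUc z).1 ω) (hUc z).2 t
  rw [hlaw]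
  set H : Measure (GaugeConfig 3 L (Matrix.specialUnitaryGroup (Fin 2) ℂ)) :=
    Measure.pi fun _ : Edge 3 L => haarProbability (Matrix.specialUnitaryGroup (Fin 2) ℂ) with hH
  haveI : IsProbabilityMeasure H := by rw [hH]; infer_instance
  set k : GaugeConfig 3 L (Matrix.specialUnitaryGroup (Fin 2) ℂ) → ℝ := fun y =>
    ∏ e, ∑' n : ℕ, ((n : ℝ) + 1) * Real.exp (-((n : ℝ) * ((n : ℝ) + 2) / 2) * t) * su2Char n (y e * (z e)⁻¹) with hk
  have hk_cont : Continuous k := continuous_prod_heatKernelSU2 ht z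
  have hkC_nonneg : ∀ y, 0 ≤ k y + C := fun y => by linarith [(abs_le.1 (hC y)).1]
  have hkC_meas : Measurable fun y => ENNReal.ofReal (k y + C) :=
    ENNReal.measurable_ofReal.comp (hk_cont.add continuous_const).measurable
  have hmU : Measurable (Uc z t) := ((hUc z).2.adapted t).mono (hWc.natFiltration.le t) le_rfl
  set lawY : Measure (GaugeConfig 3 L (Matrix.specialUnitaryGroup (Fin 2) ℂ)) :=
    (Measure.pi fun _ : Edge 3 L × NoiseIdx 2 => preWienerMeasure).map (Uc z t) with hlawY
  haveI : IsProbabilityMeasure lawY := Measure.isProbabilityMeasure_map hmU.aemeasurable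
  haveI hfinC : IsFiniteMeasure ((ENNReal.ofReal C) • H) :=
    ⟨by rw [Measure.smul_apply, smul_eq_mul]; exact ENNReal.mul_lt_top ENNReal.ofReal_lt_top (measure_lt_top _ _)⟩
  haveI : IsFiniteMeasure (H.withDensity fun y => ENNReal.ofReal (k y + C)) := by
    refine isFiniteMeasure_withDensity ?_
    have h1 : ∫⁻ y, ENNReal.ofReal (k y + C) ∂H ≤ ∫⁻ _y, ENNReal.ofReal (2 * C) ∂H :=
      lintegral_mono fun y => ENNReal.ofReal_le_ofReal (by linarith [(abs_le.1 (hC y)).2])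
    rw [lintegral_const, measure_univ, mul_one] at h1
    exact ne_top_of_le_ne_top ENNReal.ofReal_ne_top h1
  refine measure_eq_of_forall_integral_prod_gegenbauer_eq (L := L) fun g m => ?_
  have hcontF : Continuous fun y : GaugeConfig 3 L (Matrix.specialUnitaryGroup (Fin 2) ℂ) =>
      ∏ e, gegenbauerSum 1 (m e) (hsForm 2 (fundamentalRep (Fin 2) (g e)) (fundamentalRep (Fin 2) (y e)) / 2) :=
    continuous_prod_gegenbauer_latitude g m
  obtain ⟨MF, -, hMF⟩ := exists_abs_le_of_continuous hcontF
  have hint : ∀ (ν : Measure (GaugeConfig 3 L (Matrix.specialUnitaryGroup (Fin 2) ℂ))) [IsFiniteMeasure ν],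
      Integrable (fun y => ∏ e, gegenbauerSum 1 (m e)
        (hsForm 2 (fundamentalRep (Fin 2) (g e)) (fundamentalRep (Fin 2) (y e)) / 2)) ν := fun ν _ =>
    Integrable.of_bound hcontF.measurable.aestronglyMeasurable MF (Filter.Eventually.of_forall fun y => by
      rw [Real.norm_eq_abs]; exact hMF y)
  obtain ⟨Mk, -, hMk⟩ := exists_abs_le_of_continuous hk_cont
  have hint_kF : Integrable (fun y => (∏ e, gegenbauerSum 1 (m e)
      (hsForm 2 (fundamentalRep (Fin 2) (g e)) (fundamentalRep (Fin 2) (y e)) / 2)) * k y) H :=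
    Integrable.of_bound (hcontF.mul hk_cont).measurable.aestronglyMeasurable (MF * Mk)
      (Filter.Eventually.of_forall fun y => by
        rw [Real.norm_eq_abs, abs_mul]
        exact mul_le_mul (hMF y) (hMk y) (abs_nonneg _) ((abs_nonneg _).trans (hMF y)))
  rw [integral_add_measure (hint lawY) (hint _), integral_smul_measure, ENNReal.toReal_ofReal hC0, smul_eq_mul, hlawY,
    integral_map hmU.aemeasurable hcontF.aestronglyMeasurable, integral_prod_gegenbauer_latitude hWc Uc hUc hUm z g m t,
    integral_withDensity_eq_integral_toReal_smul hkC_meas (Filter.Eventually.of_forall fun y => ENNReal.ofReal_lt_top)]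
  simp_rw [ENNReal.toReal_ofReal (hkC_nonneg _), smul_eq_mul]
  have hsplit : (fun y => (k y + C) * ∏ e, gegenbauerSum 1 (m e)
      (hsForm 2 (fundamentalRep (Fin 2) (g e)) (fundamentalRep (Fin 2) (y e)) / 2)) =
      fun y => (∏ e, gegenbauerSum 1 (m e) (hsForm 2 (fundamentalRep (Fin 2) (g e)) (fundamentalRep (Fin 2) (y e)) / 2)) * k y +
        C * ∏ e, gegenbauerSum 1 (m e) (hsForm 2 (fundamentalRep (Fin 2) (g e)) (fundamentalRep (Fin 2) (y e)) / 2) := by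
    funext y; ring
  rw [hsplit, integral_add hint_kF ((hint H).const_mul C), integral_const_mul, hk, hH,
    integral_prod_gegenbauer_mul_prod_heatKernel ht z g m]

/-- ★ **The product heat kernel is non-negative for all `t > 0`**: `0 ≤ ∏_e h_t(y_e z_e⁻¹)` for every `z, y`.  From the shifted
identity: `∫_A k_t dHaar = law(U_t)(A) ≥ 0` for every measurable `A`, so `k_t ≥ 0` a.e.; `k_t` is continuous and Haar charges
open sets. [folklore] -/
theorem prod_heatKernelSU2_nonneg {t : ℝ} (ht : 0 < t) (z y : GaugeConfig 3 L (Matrix.specialUnitaryGroup (Fin 2) ℂ)) :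
    0 ≤ ∏ e, ∑' n : ℕ, ((n : ℝ) + 1) * Real.exp (-((n : ℝ) * ((n : ℝ) + 2) / 2) * t) * su2Char n (y e * (z e)⁻¹) := by
  classical
  -- read `t` as a non-negative real
  obtain ⟨tn, rfl⟩ : ∃ tn : ℝ≥0, (tn : ℝ) = t := ⟨⟨t, ht.le⟩, rfl⟩
  haveI := secondCountableTopology_su2
  haveI := borelSpace_config L
  haveI : IsProbabilityMeasure (haarProbability (Matrix.specialUnitaryGroup (Fin 2) ℂ)) := inferInstance
  set H : Measure (GaugeConfig 3 L (Matrix.specialUnitaryGroup (Fin 2) ℂ)) :=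
    Measure.pi fun _ : Edge 3 L => haarProbability (Matrix.specialUnitaryGroup (Fin 2) ℂ) with hH
  haveI : IsProbabilityMeasure H := by rw [hH]; infer_instance
  haveI : H.IsOpenPosMeasure := by
    rw [hH]
    haveI : ∀ _e : Edge 3 L, (haarProbability (Matrix.specialUnitaryGroup (Fin 2) ℂ)).IsOpenPosMeasure := fun _ => by
      unfold haarProbability; infer_instance
    infer_instance
  set k : GaugeConfig 3 L (Matrix.specialUnitaryGroup (Fin 2) ℂ) → ℝ := fun y =>
    ∏ e, ∑' n : ℕ, ((n : ℝ) + 1) * Real.exp (-((n : ℝ) * ((n : ℝ) + 2) / 2) * (tn : ℝ)) * su2Char n (y e * (z e)⁻¹) with hk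
  have hk_cont : Continuous k := continuous_prod_heatKernelSU2 ht z
  obtain ⟨C, hC0, hC⟩ := exists_abs_le_of_continuous hk_cont
  -- a `β' = 0` solution from `z` (regular flow on the product Wiener space) and the shifted identity at `t`
  haveI := isProbabilityMeasure_piWiener (Edge 3 L × NoiseIdx 2)
  have hWc := isFlatBrownian_piWiener 3 L (NoiseIdx 2)
  obtain ⟨Uc, G, hUc, -, -, -, -⟩ := exists_regularFlow L 0 hWc
  have heq := map_add_smul_haar_eq_beta_zero (L := L) ht z hWc (fun ω => (hUc z).1 ω) (hUc z).2 hC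
  rw [← hH] at heq
  have hmU : Measurable (Uc z tn) := ((hUc z).2.adapted tn).mono (hWc.natFiltration.le tn) le_rfl
  haveI : IsProbabilityMeasure ((Measure.pi fun _ : Edge 3 L × NoiseIdx 2 => preWienerMeasure).map (Uc z tn)) :=
    Measure.isProbabilityMeasure_map hmU.aemeasurable
  -- `∫_A k ≥ 0` for every measurable `A`
  have hkint : Integrable k H := Integrable.of_bound hk_cont.measurable.aestronglyMeasurable C
    (Filter.Eventually.of_forall fun y => by rw [Real.norm_eq_abs]; exact hC y)
  have hset : ∀ A : Set (GaugeConfig 3 L (Matrix.specialUnitaryGroup (Fin 2) ℂ)), MeasurableSet A → H A < ⊤ →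
      0 ≤ ∫ y in A, k y ∂H := by
    intro A hA _
    have h1 := congrArg (fun ν : Measure _ => ν A) heq
    simp only [Measure.add_apply, Measure.smul_apply, smul_eq_mul, withDensity_apply _ hA] at h1
    -- `∫_A ofReal(k + C) = ofReal(∫_A k + C H(A))`
    have hkC_nonneg : ∀ y, 0 ≤ k y + C := fun y => by linarith [(abs_le.1 (hC y)).1]
    have hintA : Integrable (fun y => k y + C) (H.restrict A) := (hkint.add (integrable_const C)).restrict
    have h2 : ∫⁻ y in A, ENNReal.ofReal (k y + C) ∂H = ENNReal.ofReal (∫ y in A, (k y + C) ∂H) :=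
      (ofReal_integral_eq_lintegral_ofReal (μ := H.restrict A) (f := fun y => k y + C) hintA
        (Filter.Eventually.of_forall fun y => hkC_nonneg y)).symm
    have h3 : ∫ y in A, (k y + C) ∂H = (∫ y in A, k y ∂H) + C * (H A).toReal := by
      rw [integral_add hkint.restrict (integrable_const C), integral_const, smul_eq_mul, measureReal_restrict_apply_univ,
        measureReal_def, mul_comm]
    have hnn : 0 ≤ (∫ y in A, k y ∂H) + C * (H A).toReal := by
      rw [← h3]; exact setIntegral_nonneg hA fun y _ => hkC_nonneg y
    -- compare real numbers
    have hfin : ((Measure.pi fun _ : Edge 3 L × NoiseIdx 2 => preWienerMeasure).map (Uc z tn)) A ≠ ⊤ := measure_ne_top _ _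
    rw [h2, h3] at h1
    have h4 := congrArg ENNReal.toReal h1
    rw [ENNReal.toReal_add hfin (ENNReal.mul_ne_top ENNReal.ofReal_ne_top (measure_ne_top _ _)), ENNReal.toReal_mul,
      ENNReal.toReal_ofReal hC0, ENNReal.toReal_ofReal hnn] at h4
    have h5 : 0 ≤ (((Measure.pi fun _ : Edge 3 L × NoiseIdx 2 => preWienerMeasure).map (Uc z tn)) A).toReal :=
      ENNReal.toReal_nonneg
    linarith
  have hae : 0 ≤ᵐ[H] k := ae_nonneg_of_forall_setIntegral_nonneg hkint hset
  -- continuity + open-positivity: everywhere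
  by_contra hneg
  have hneg' : k y < 0 := not_le.1 hneg
  have hopen : IsOpen {w | k w < 0} := isOpen_lt hk_cont continuous_const
  have hpos : 0 < H {w | k w < 0} := hopen.measure_pos H ⟨y, hneg'⟩
  have hae2 : ∀ᵐ w ∂H, ¬ (k w < 0) := hae.mono fun w hw => not_lt.2 hw
  have hnull : H {w | k w < 0} = 0 := by
    have h := ae_iff.1 hae2
    simpa only [not_not] using h
  exact absurd hnull hpos.ne'

/-- ★★ **The law of the `β' = 0` SZZ dynamics is the product heat kernel times Haar, for EVERY `t > 0`** (any solution from a
deterministic start on any space): `law(U_t) = (∏_e h_t(y_e z_e⁻¹)) · Haar^{⊗E}(dy)`. [folklore] -/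
theorem map_eq_heatKernel_beta_zero_of_pos {t : ℝ≥0} (ht : 0 < (t : ℝ)) (z : GaugeConfig 3 L (Matrix.specialUnitaryGroup (Fin 2) ℂ))
    {Ω : Type} [MeasurableSpace Ω] {P : Measure Ω} [IsProbabilityMeasure P]
    {W : ℝ≥0 → Ω → (Edge 3 L × NoiseIdx 2 → ℝ)} (hW : IsFlatBrownian W P)
    {U : ℝ≥0 → Ω → GaugeConfig 3 L (Matrix.specialUnitaryGroup (Fin 2) ℂ)} (hU0 : ∀ ω, U 0 ω = z)
    (hU : (latticeLangevinDynamics (fundamentalLatticeRep 2) 0).IsSolution (fundamentalRep (Fin 2)) hW.natFiltration P W U) :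
    P.map (U t) = (Measure.pi fun _ : Edge 3 L => haarProbability (Matrix.specialUnitaryGroup (Fin 2) ℂ)).withDensity
      (fun y => ENNReal.ofReal (∏ e, ∑' n : ℕ, ((n : ℝ) + 1) * Real.exp (-((n : ℝ) * ((n : ℝ) + 2) / 2) * t) *
        su2Char n (y e * (z e)⁻¹))) := by
  classical
  haveI := secondCountableTopology_su2
  haveI := borelSpace_config L
  haveI : IsProbabilityMeasure (haarProbability (Matrix.specialUnitaryGroup (Fin 2) ℂ)) := inferInstance
  set H : Measure (GaugeConfig 3 L (Matrix.specialUnitaryGroup (Fin 2) ℂ)) :=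
    Measure.pi fun _ : Edge 3 L => haarProbability (Matrix.specialUnitaryGroup (Fin 2) ℂ) with hH
  haveI : IsProbabilityMeasure H := by rw [hH]; infer_instance
  set k : GaugeConfig 3 L (Matrix.specialUnitaryGroup (Fin 2) ℂ) → ℝ := fun y =>
    ∏ e, ∑' n : ℕ, ((n : ℝ) + 1) * Real.exp (-((n : ℝ) * ((n : ℝ) + 2) / 2) * t) * su2Char n (y e * (z e)⁻¹) with hk
  have hk_cont : Continuous k := continuous_prod_heatKernelSU2 ht z
  obtain ⟨C, hC0, hC⟩ := exists_abs_le_of_continuous hk_cont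
  have heq := map_add_smul_haar_eq_beta_zero (L := L) ht z hW hU0 hU hC
  rw [← hH] at heq
  have hk0 : ∀ y, 0 ≤ k y := fun y => prod_heatKernelSU2_nonneg (L := L) ht z y
  -- split the density `ofReal (k + C) = ofReal k + ofReal C`
  have hsplit : (H.withDensity fun y => ENNReal.ofReal (k y + C)) =
      H.withDensity (fun y => ENNReal.ofReal (k y)) + (ENNReal.ofReal C) • H := by
    have e1 : (fun y => ENNReal.ofReal (k y + C)) = (fun y => ENNReal.ofReal (k y)) + fun _ => ENNReal.ofReal C := by
      funext y
      simp only [Pi.add_apply]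
      rw [ENNReal.ofReal_add (hk0 y) hC0]
    have hmk : Measurable (fun y => ENNReal.ofReal (k y)) := ENNReal.measurable_ofReal.comp hk_cont.measurable
    rw [e1, withDensity_add_left hmk, withDensity_const]
  rw [hsplit] at heq
  -- cancel the finite measure `C • H`
  have hmU : Measurable (U t) := (hU.adapted t).mono (hW.natFiltration.le t) le_rfl
  ext A hA
  have h1 := congrArg (fun ν : Measure _ => ν A) heq
  simp only [Measure.add_apply, Measure.smul_apply, smul_eq_mul] at h1
  have hfin : ENNReal.ofReal C * H A ≠ ⊤ := ENNReal.mul_ne_top ENNReal.ofReal_ne_top (measure_ne_top _ _)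
  exact (ENNReal.add_left_inj hfin).1 h1

/-- **The SU(2) heat kernel series is positive at the identity**: `h_t(1) = Σ (n+1)² e^{-n(n+2)t/2} > 0`. [folklore] -/
theorem heatKernelSU2_one_pos {t : ℝ} (ht : 0 < t) :
    0 < ∑' n : ℕ, ((n : ℝ) + 1) * Real.exp (-((n : ℝ) * ((n : ℝ) + 2) / 2) * t) *
      su2Char n (1 : Matrix.specialUnitaryGroup (Fin 2) ℂ) := by
  have hsum := summable_heatKernelSU2 ht (1 : Matrix.specialUnitaryGroup (Fin 2) ℂ)
  have hterm : ∀ n : ℕ, 0 ≤ ((n : ℝ) + 1) * Real.exp (-((n : ℝ) * ((n : ℝ) + 2) / 2) * t) *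
      su2Char n (1 : Matrix.specialUnitaryGroup (Fin 2) ℂ) := by
    intro n
    rw [su2Char_eq_gegenbauerSum]
    have h1 : (((1 : Matrix.specialUnitaryGroup (Fin 2) ℂ) : Matrix (Fin 2) (Fin 2) ℂ).trace.re / 2) = 1 := by
      simp [Matrix.trace]
    rw [h1, gegenbauerSum_one_at_one]
    positivity
  have h0 : 0 < ((0 : ℕ) : ℝ) + 1 := by norm_num
  refine lt_of_lt_of_le ?_ (Summable.le_tsum hsum 0 fun n _ => hterm n)
  rw [su2Char_zero_apply]
  positivity

/-- ★ **The SU(2) heat kernel is non-negative for all `t > 0`**: `h_t(V) = Σ (n+1) e^{-n(n+2)t/2} χ_n(V) ≥ 0` on all of `SU(2)`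
(product kernel on the one-site torus with `V` on one link and `1` on the others, `h_t(1) > 0`). [folklore] -/
theorem heatKernelSU2_nonneg {t : ℝ} (ht : 0 < t) (V : Matrix.specialUnitaryGroup (Fin 2) ℂ) :
    0 ≤ ∑' n : ℕ, ((n : ℝ) + 1) * Real.exp (-((n : ℝ) * ((n : ℝ) + 2) / 2) * t) * su2Char n V := by
  classical
  -- one-site torus `L = 1`: three links; put `V` on one of them
  obtain ⟨e₀⟩ : Nonempty (Edge 3 1) := ⟨((fun _ => 0), 0)⟩
  set y : GaugeConfig 3 1 (Matrix.specialUnitaryGroup (Fin 2) ℂ) := Function.update (fun _ => 1) e₀ V with hy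
  have h := prod_heatKernelSU2_nonneg (L := 1) ht (fun _ => 1) y
  have hsplit : (∏ e : Edge 3 1, ∑' n : ℕ, ((n : ℝ) + 1) * Real.exp (-((n : ℝ) * ((n : ℝ) + 2) / 2) * t) *
      su2Char n (y e * ((fun _ : Edge 3 1 => (1 : Matrix.specialUnitaryGroup (Fin 2) ℂ)) e)⁻¹)) =
      (∑' n : ℕ, ((n : ℝ) + 1) * Real.exp (-((n : ℝ) * ((n : ℝ) + 2) / 2) * t) * su2Char n V) *
        ∏ e ∈ Finset.univ.erase e₀, ∑' n : ℕ, ((n : ℝ) + 1) * Real.exp (-((n : ℝ) * ((n : ℝ) + 2) / 2) * t) *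
          su2Char n (1 : Matrix.specialUnitaryGroup (Fin 2) ℂ) := by
    rw [← Finset.mul_prod_erase _ _ (Finset.mem_univ e₀)]
    congr 1
    · simp [hy]
    · refine Finset.prod_congr rfl fun e he => ?_
      have hne : e ≠ e₀ := (Finset.mem_erase.1 he).1
      simp [hy, Function.update_of_ne hne]
  rw [hsplit] at h
  have hrest : 0 < ∏ e ∈ Finset.univ.erase e₀, ∑' n : ℕ, ((n : ℝ) + 1) * Real.exp (-((n : ℝ) * ((n : ℝ) + 2) / 2) * t) *
      su2Char n (1 : Matrix.specialUnitaryGroup (Fin 2) ℂ) :=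
    Finset.prod_pos fun _ _ => heatKernelSU2_one_pos ht
  exact nonneg_of_mul_nonneg_left h hrest

end Summit.QuantumFields.YangMills.Theorems.ColdStartUniversality

end
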